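import Mathlib
import HarnessLib
import Literature.Analysis.FluidPDE.SpaceTimeParametricIntegral
import Summits.HubbardSuperconductivity.HubbardSuperconductivity.Theorems.KLProgrammeC4aLoopIBPBounds
import Summits.HubbardSuperconductivity.HubbardSuperconductivity.Theorems.KLProgrammeC4aLevelChart
import Summits.HubbardSuperconductivity.HubbardSuperconductivity.Theorems.KLProgrammeC4aFoldCurvaturePartnerBand
import Summits.HubbardSuperconductivity.HubbardSuperconductivity.Theorems.KLProgrammeC4aFoldBoxGlue

/-!
# Route `KLProgramme` — crux C4a, S3 brick (B4) «(U1)-LAWS» part 8: the MONOTONE (transversal) BOX — where the partner band is strictly monotone in the loop angle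
# (`|∂_vē| ≥ m` on the box), ONE loop integration by parts prices `F(ϑ)` by `W·(X₀G₂/m² + X₁/m)/m · 4√K₀ · 4√hi`, `lo`-free, for ALL loop levels

Cell `gate-hubbard-kl`, seat hubbard-kl-k3c3-p3 (g32; row «implicit-function / monotonicity route for μ(n)»).  Located brick for the (C)-closer lane / the (M4)
assembly of the umklapp first-order ϑ-layer (stub (C) `stub_twoLeg_curvature` of `KLRegimeEngineV17F2`, stmt-HubbardSuperconductivity-20437), memo
HOME/hubbard-kl-k3c3-p3/U1-CAUSTIC-SUP.md §13 (boxes WITHOUT a near-caustic witness, transversal branch; B4-GEN-WINDOW §2 (g20) is the device).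

WHY.  Per box `[α,β]_ϑ × [φa,φb]_loop` the (M4) dispatch is: near-caustic (part 6 + the cover theorem), far (part 7), or TRANSVERSAL: the loop-angle slope of the partner band
`ē(e,v) = e_K(S(ϑ) − Φ(e,v+θ))` is bounded below, `|∂_vē| ≥ m`, on the whole box (umklapp crossings away from their caustic; windows adjacent to a crossing).  There the
first-order integrand does not converge absolutely (`∬ de dv/max(|e|,|ē|)² ≍ log(1/lo)`), but ONE integration by parts in the loop angle does it: with a weight `X(e,·)`
compactly supported in the open loop window (the partition-of-unity bump), `…C4aLoopIBPBounds.norm_intervalIntegral_smul_iteratedDeriv_comp_le_level` (g20) gives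
`|∫ X·(K e)′(ē) dv| ≤ (X₀G₂/m² + X₁/m)·m⁻¹·|∫_{ē(φa)}^{ē(φb)} |K e|| `, the level integral of the ENVELOPE `|K e y| ≤ 1/max(t,|y|)`, `t = max(lo,|e|)` (scale-regular on the
strip, `|e|` off it), is `≤ 4√K₀/√t` (§1), and the level layer `∫_{−hi}^{hi} w(e)·(√max(lo,|e|))⁻¹ de ≤ W·4√hi` (§1) is `lo`-FREE.  No fold structure, no sign condition.
* §1 **`intervalIntegral_inv_max_abs_le`** (`∫_{−K}^{K} (max t |y|)⁻¹ dy ≤ 4√K/√t`, `0 < t ≤ K`) and **`intervalIntegral_inv_sqrt_max_abs_le`** (`∫_{−h}^{h} (√(max t |e|))⁻¹ de ≤ 4√h`).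
* §2 **`levelLayer_intervalIntegrable`**: the level layer `e ↦ w(e)·|∫_V X(e,v)·(K e)′(ē(e,v)) dv|` is interval-integrable on `[−hi,hi]` from joint continuity
  (`…C4aLevelChart.contDiffOn_levelPoint` + `Literature.Analysis.FluidPDE.continuousOn_parametric_intervalIntegral`) — the integrability row of parts 4c/6/8, discharged.
* §3 **`abs_loopIntegral_monotone_le`** (one `(ϑ, e)`), **`monotoneBox_pointwise_le`**, **`monotoneBox_integral_le`** (HEADLINE):
  `∫_{α..β} |∫_{−hi..hi}∫_{φa..φb} w·(X·(K e)′(ē))| dϑ ≤ (β − α)·(W·((X₀·(G₂/m²) + X₁·m⁻¹)·(m⁻¹·(4√K₀)))·(4√hi))`.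
Sizes binder shape; nothing asserts (C), K3 or superconductivity.
References: FST II CPAM 51 (1998) §3 [cite: FeldmanSalmhoferTrubowitz1998]; Salmhofer 1999 §4.5.3 [cite: Salmhofer1999].
-/

noncomputable section

namespace Summit.HubbardSuperconductivity.HubbardSuperconductivity.Theorems.C4a

set_option linter.dupNamespace false -- summit = problem name (single-conjunct summit), D-0017

open Real Set MeasureTheory intervalIntegral
open scoped Interval
open Literature.MathematicalPhysics.QuantumLattice Literature.MathematicalPhysics.QuantumLattice.BandSectorCounting
open Literature.MathematicalPhysics.QuantumLattice.FermiRG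
open Summit.HubbardSuperconductivity.HubbardSuperconductivity.Theorems.KLRegimeSplit
open Summit.HubbardSuperconductivity.HubbardSuperconductivity.Theorems.DispersionFlow
open Summit.HubbardSuperconductivity.HubbardSuperconductivity.Theorems.PerturbedFermiCurve

/-! ## §1 Two elementary level integrals -/

/-- `∫_t^K dy/(√t·√y) = 2√K/√t − 2` for `0 < t ≤ K` (as an inequality). [folklore] -/
theorem intervalIntegral_inv_sqrt_mul_le {t K : ℝ} (ht : 0 < t) (htK : t ≤ K) :
    ∫ y in t..K, (Real.sqrt t * Real.sqrt y)⁻¹ ≤ 2 * Real.sqrt K / Real.sqrt t - 2 := by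
  have hst : 0 < Real.sqrt t := Real.sqrt_pos.2 ht
  have hderiv : ∀ y ∈ uIcc t K, HasDerivAt (fun y : ℝ => 2 * Real.sqrt y / Real.sqrt t) ((Real.sqrt t * Real.sqrt y)⁻¹) y := fun y hy => by
    rw [uIcc_of_le htK] at hy
    have hy0 : 0 < y := ht.trans_le hy.1
    have hsy : 0 < Real.sqrt y := Real.sqrt_pos.2 hy0
    have h := ((Real.hasDerivAt_sqrt hy0.ne').const_mul 2).div_const (Real.sqrt t)
    refine h.congr_deriv ?_
    field_simp
  have hcont : ContinuousOn (fun y : ℝ => (Real.sqrt t * Real.sqrt y)⁻¹) (uIcc t K) := by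
    refine ContinuousOn.inv₀ (by fun_prop) fun y hy => ?_
    rw [uIcc_of_le htK] at hy
    exact (mul_pos hst (Real.sqrt_pos.2 (ht.trans_le hy.1))).ne'
  rw [intervalIntegral.integral_eq_sub_of_hasDerivAt hderiv (hcont.intervalIntegrable)]
  have : 2 * Real.sqrt t / Real.sqrt t = 2 := by field_simp
  linarith

/-- **`∫_{−K}^{K} (max t |y|)⁻¹ dy ≤ 4√K/√t`** for `0 < t ≤ K` (split at `|y| = t`; beyond, `1/|y| ≤ 1/√(t|y|)`). [folklore] -/
theorem intervalIntegral_inv_max_abs_le {t K : ℝ} (ht : 0 < t) (htK : t ≤ K) :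
    ∫ y in (-K)..K, (max t |y|)⁻¹ ≤ 4 * Real.sqrt K / Real.sqrt t := by
  have hK : 0 < K := ht.trans_le htK
  have hst : 0 < Real.sqrt t := Real.sqrt_pos.2 ht
  set h : ℝ → ℝ := fun y => (max t |y|)⁻¹ with hh
  have hcont : Continuous h := by
    refine Continuous.inv₀ (continuous_const.max continuous_abs) fun y => (lt_max_of_lt_left ht).ne'
  have hint : ∀ a b : ℝ, IntervalIntegrable h volume a b := fun a b => hcont.intervalIntegrable _ _
  -- evenness: the negative half equals the positive half
  have hneg : ∫ y in (-K)..0, h y = ∫ y in (0 : ℝ)..K, h y := by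
    have h1 : ∫ y in (0 : ℝ)..K, h (-y) = ∫ y in (-K)..(-0), h y := intervalIntegral.integral_comp_neg h
    rw [neg_zero] at h1
    rw [← h1]
    refine intervalIntegral.integral_congr fun y _ => ?_
    simp [hh, abs_neg]
  have hsplit : ∫ y in (-K)..K, h y = 2 * ∫ y in (0 : ℝ)..K, h y := by
    rw [← intervalIntegral.integral_add_adjacent_intervals (hint (-K) 0) (hint 0 K), hneg]; ring
  -- the positive half: `[0,t]` constant, `[t,K]` by the square root
  have hlow : ∫ y in (0 : ℝ)..t, h y ≤ 1 := by
    have hb := intervalIntegral.norm_integral_le_of_norm_le_const (a := 0) (b := t) (f := h) (C := t⁻¹) fun y hy => by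
      rw [uIoc_of_le ht.le] at hy
      rw [Real.norm_eq_abs, hh]
      simp only
      rw [abs_of_pos (inv_pos.2 (lt_max_of_lt_left ht))]
      exact inv_anti₀ ht (le_max_left _ _)
    rw [Real.norm_eq_abs, sub_zero, abs_of_pos ht] at hb
    have : t⁻¹ * t = 1 := inv_mul_cancel₀ ht.ne'
    exact (le_abs_self _).trans (hb.trans this.le)
  have hhigh : ∫ y in t..K, h y ≤ 2 * Real.sqrt K / Real.sqrt t - 2 := by
    refine le_trans (intervalIntegral.integral_mono_on htK (hint t K) ?_ fun y hy => ?_) (intervalIntegral_inv_sqrt_mul_le ht htK)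
    · refine ContinuousOn.intervalIntegrable (ContinuousOn.inv₀ (by fun_prop) fun y hy => ?_)
      rw [uIcc_of_le htK] at hy
      exact (mul_pos hst (Real.sqrt_pos.2 (ht.trans_le hy.1))).ne'
    · have hy0 : 0 < y := ht.trans_le hy.1
      rw [hh]
      simp only
      rw [max_eq_right (by rw [abs_of_pos hy0]; exact hy.1), abs_of_pos hy0]
      refine inv_anti₀ (by positivity) ?_
      calc Real.sqrt t * Real.sqrt y ≤ Real.sqrt y * Real.sqrt y := mul_le_mul_of_nonneg_right (Real.sqrt_le_sqrt hy.1) (Real.sqrt_nonneg _)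
        _ = y := Real.mul_self_sqrt hy0.le
  have hpos : ∫ y in (0 : ℝ)..K, h y = (∫ y in (0 : ℝ)..t, h y) + ∫ y in t..K, h y :=
    (intervalIntegral.integral_add_adjacent_intervals (hint 0 t) (hint t K)).symm
  rw [hsplit, hpos]
  have : 4 * Real.sqrt K / Real.sqrt t = 2 * (2 * Real.sqrt K / Real.sqrt t) := by ring
  rw [this]
  linarith

/-- **`∫_{−h}^{h} (√(max t |e|))⁻¹ de ≤ 4√h`** for `0 < t ≤ h`. [folklore] -/
theorem intervalIntegral_inv_sqrt_max_abs_le {t hh : ℝ} (ht : 0 < t) (hth : t ≤ hh) :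
    ∫ e in (-hh)..hh, (Real.sqrt (max t |e|))⁻¹ ≤ 4 * Real.sqrt hh := by
  have hh0 : 0 < hh := ht.trans_le hth
  have hst : 0 < Real.sqrt t := Real.sqrt_pos.2 ht
  set h : ℝ → ℝ := fun e => (Real.sqrt (max t |e|))⁻¹ with hhdef
  have hcont : Continuous h := by
    refine Continuous.inv₀ ((continuous_const.max continuous_abs).sqrt) fun e => (Real.sqrt_pos.2 (lt_max_of_lt_left ht)).ne'
  have hint : ∀ a b : ℝ, IntervalIntegrable h volume a b := fun a b => hcont.intervalIntegrable _ _
  have hneg : ∫ e in (-hh)..0, h e = ∫ e in (0 : ℝ)..hh, h e := by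
    have h1 : ∫ e in (0 : ℝ)..hh, h (-e) = ∫ e in (-hh)..(-0), h e := intervalIntegral.integral_comp_neg h
    rw [neg_zero] at h1
    rw [← h1]
    refine intervalIntegral.integral_congr fun e _ => ?_
    simp [hhdef, abs_neg]
  have hsplit : ∫ e in (-hh)..hh, h e = 2 * ∫ e in (0 : ℝ)..hh, h e := by
    rw [← intervalIntegral.integral_add_adjacent_intervals (hint (-hh) 0) (hint 0 hh), hneg]; ring
  have hlow : ∫ e in (0 : ℝ)..t, h e ≤ Real.sqrt t := by
    have hb := intervalIntegral.norm_integral_le_of_norm_le_const (a := 0) (b := t) (f := h) (C := (Real.sqrt t)⁻¹) fun e he => by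
      rw [Real.norm_eq_abs, hhdef]
      simp only
      rw [abs_of_pos (inv_pos.2 (Real.sqrt_pos.2 (lt_max_of_lt_left ht)))]
      exact inv_anti₀ hst (Real.sqrt_le_sqrt (le_max_left _ _))
    rw [Real.norm_eq_abs, sub_zero, abs_of_pos ht] at hb
    have : (Real.sqrt t)⁻¹ * t = Real.sqrt t := by
      rw [inv_mul_eq_div, div_eq_iff hst.ne', Real.mul_self_sqrt ht.le]
    exact (le_abs_self _).trans (hb.trans this.le)
  have hhigh : ∫ e in t..hh, h e ≤ 2 * Real.sqrt hh - 2 * Real.sqrt t := by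
    have hderiv : ∀ e ∈ uIcc t hh, HasDerivAt (fun e : ℝ => 2 * Real.sqrt e) ((Real.sqrt e)⁻¹) e := fun e he => by
      rw [uIcc_of_le hth] at he
      have he0 : 0 < e := ht.trans_le he.1
      have h := (Real.hasDerivAt_sqrt he0.ne').const_mul 2
      refine h.congr_deriv ?_
      have : 0 < Real.sqrt e := Real.sqrt_pos.2 he0
      field_simp
    have hci : ContinuousOn (fun e : ℝ => (Real.sqrt e)⁻¹) (uIcc t hh) := by
      refine ContinuousOn.inv₀ (by fun_prop) fun e he => ?_
      rw [uIcc_of_le hth] at he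
      exact (Real.sqrt_pos.2 (ht.trans_le he.1)).ne'
    have heq : ∫ e in t..hh, h e = ∫ e in t..hh, (Real.sqrt e)⁻¹ := by
      refine intervalIntegral.integral_congr fun e he => ?_
      rw [uIcc_of_le hth] at he
      have he0 : 0 < e := ht.trans_le he.1
      simp only [hhdef]
      rw [max_eq_right (by rw [abs_of_pos he0]; exact he.1), abs_of_pos he0]
    rw [heq, intervalIntegral.integral_eq_sub_of_hasDerivAt hderiv hci.intervalIntegrable]
  have hpos : ∫ e in (0 : ℝ)..hh, h e = (∫ e in (0 : ℝ)..t, h e) + ∫ e in t..hh, h e :=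
    (intervalIntegral.integral_add_adjacent_intervals (hint 0 t) (hint t hh)).symm
  rw [hsplit, hpos]
  have hst0 : 0 ≤ Real.sqrt t := Real.sqrt_nonneg _
  linarith

/-! ## §2 The level layer is interval-integrable (joint continuity) -/

section Sizes

variable {K : TrigPolyC4v} {A : ℝ} (hA : ∀ p : Momentum, ∀ j ≤ 2, ‖iteratedFDeriv ℝ j (frameShift K) p‖ ≤ A) (hA20 : A ≤ 1 / 20)
  (hd : klCurveD ≤ (bandBounds (show (-4 : ℝ) < -1.1 by norm_num) (show (-1.1 : ℝ) ≤ -0.1 by norm_num)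
    (show (-0.1 : ℝ) < 0 by norm_num)).Dtmin - 2 * A)
  {μ r : ℝ} (hr : 0 < r) (hlo : (-1.1 : ℝ) < μ - r - A) (hhi : μ + r + A < -0.1)
include hA hA20 hd hr hlo hhi

omit hA20 hr in
/-- **JOINT CONTINUITY OF THE BOX INTEGRAND** in `(v, e)` on `ℝ × [−hi,hi]` (`hi < r`): `X` jointly continuous on `[−hi,hi] × ℝ`, `∂ᵤK` jointly continuous. -/
theorem continuousOn_box_integrand (S : Momentum) (θ : ℝ) {hi : ℝ} (hhir : hi < r) {Kr X : ℝ → ℝ → ℝ}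
    (hX2 : ContinuousOn (fun p : ℝ × ℝ => X p.1 p.2) (Icc (-hi) hi ×ˢ univ)) (hKc : Continuous fun p : ℝ × ℝ => deriv (Kr p.1) p.2) :
    ContinuousOn (fun p : ℝ × ℝ => X p.2 p.1 * deriv (Kr p.2) (frameLevel μ K (S - levelPoint μ K p.2 (p.1 + θ)))) (univ ×ˢ Icc (-hi) hi) := by
  set B := bandBounds (show (-4 : ℝ) < -1.1 by norm_num) (show (-1.1 : ℝ) ≤ -0.1 by norm_num) (show (-0.1 : ℝ) < 0 by norm_num) with hBdef
  have hADt : 2 * A < B.Dtmin := by have := klCurveD_pos; linarith only [this, hd]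
  have hlev : ContinuousOn (fun p : ℝ × ℝ => levelPoint μ K p.1 p.2) ({x : ℝ | |x| < r} ×ˢ univ) :=
    (contDiffOn_levelPoint B hA hADt hlo hhi (m := 0)).continuousOn
  have hswapθ : Continuous (fun p : ℝ × ℝ => ((p.2, p.1 + θ) : ℝ × ℝ)) := continuous_snd.prodMk (continuous_fst.add continuous_const)
  have hmapsθ : MapsTo (fun p : ℝ × ℝ => ((p.2, p.1 + θ) : ℝ × ℝ)) (univ ×ˢ Icc (-hi) hi) ({x : ℝ | |x| < r} ×ˢ univ) := fun p hp => by
    have he : p.2 ∈ Icc (-hi) hi := (mem_prod.1 hp).2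
    exact mem_prod.2 ⟨abs_lt.2 ⟨by linarith only [he.1, hhir], lt_of_le_of_lt he.2 hhir⟩, mem_univ _⟩
  have hlevθ : ContinuousOn ((fun p : ℝ × ℝ => levelPoint μ K p.1 p.2) ∘ fun p : ℝ × ℝ => ((p.2, p.1 + θ) : ℝ × ℝ)) (univ ×ˢ Icc (-hi) hi) :=
    hlev.comp hswapθ.continuousOn hmapsθ
  have hfl : Continuous (frameLevel μ K) := (EngineV8.contDiff_frameLevel μ K (n := 0)).continuous
  have hband : ContinuousOn (fun p : ℝ × ℝ => frameLevel μ K (S - levelPoint μ K p.2 (p.1 + θ))) (univ ×ˢ Icc (-hi) hi) := by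
    have h2 := hfl.comp_continuousOn ((continuousOn_const (c := S)).sub hlevθ)
    exact h2.congr fun p _ => rfl
  have hXs : ContinuousOn (fun p : ℝ × ℝ => X p.2 p.1) (univ ×ˢ Icc (-hi) hi) :=
    hX2.comp (continuous_snd.prodMk continuous_fst).continuousOn fun p hp => mem_prod.2 ⟨(mem_prod.1 hp).2, mem_univ _⟩
  exact hXs.mul (hKc.comp_continuousOn (continuousOn_snd.prodMk hband))

omit hA20 hr in
/-- **THE LEVEL LAYER IS INTERVAL-INTEGRABLE** (the integrability row of parts 4c/6/8): for `hi < r`, `X` jointly continuous on `[−hi,hi] × ℝ`, `∂ᵤK` jointly continuous and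
`w` continuous on `[−hi,hi]`, the function `e ↦ w(e)·|∫_{φa..φb} X(e,v)·(K e)′(e_K(S − Φ(e,v+θ))) dv|` is interval-integrable on `[−hi, hi]`. -/
theorem levelLayer_intervalIntegrable (S : Momentum) (θ : ℝ) {φa φb hi : ℝ} (hhi0 : 0 ≤ hi) (hhir : hi < r) {Kr X : ℝ → ℝ → ℝ} {wt : ℝ → ℝ}
    (hX2 : ContinuousOn (fun p : ℝ × ℝ => X p.1 p.2) (Icc (-hi) hi ×ˢ univ)) (hKc : Continuous fun p : ℝ × ℝ => deriv (Kr p.1) p.2)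
    (hwc : ContinuousOn wt (Icc (-hi) hi)) :
    IntervalIntegrable (fun e => wt e * |∫ v in φa..φb, X e v * deriv (Kr e) (frameLevel μ K (S - levelPoint μ K e (v + θ)))|) volume (-hi) hi := by
  have hIc : ContinuousOn (fun e => ∫ v in φa..φb, X e v * deriv (Kr e) (frameLevel μ K (S - levelPoint μ K e (v + θ)))) (Icc (-hi) hi) :=
    Literature.Analysis.FluidPDE.continuousOn_parametric_intervalIntegral
      (H := fun p : ℝ × ℝ => X p.2 p.1 * deriv (Kr p.2) (frameLevel μ K (S - levelPoint μ K p.2 (p.1 + θ))))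
      (continuousOn_box_integrand hA hd hlo hhi S θ hhir hX2 hKc) φa φb
  refine ContinuousOn.intervalIntegrable ?_
  rw [uIcc_of_le (by linarith only [hhi0] : -hi ≤ hi)]
  exact hwc.mul (continuous_abs.comp_continuousOn hIc)

/-! ## §3 The monotone box -/

omit hA20 hr in
/-- **ONE LOOP INTEGRATION BY PARTS ON A MONOTONE WINDOW**, at one `(ϑ, e)`: `|e| < r`, `φa ≤ φb`; the partner band `g = e_K(S − Φ(e,·+θ))` with `m ≤ |g′|` and
`|g″| ≤ G₂` on `[φa,φb]`; the weight `X e ∈ C¹` with `tsupport ⊆ (φa,φb)`, `|X e| ≤ X₀`, `|(X e)′| ≤ X₁` on `(φa,φb)`; the kernel `K e ∈ C¹` with the level envelope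
`|K e y| ≤ 1/max(t,|y|)` (`0 < t ≤ K₀`) and the band height `|e_K| ≤ K₀`.  THEN `|∫_{φa..φb} X(e,v)·(K e)′(g v) dv| ≤ (X₀·(G₂/m²) + X₁·m⁻¹)·(m⁻¹·(4√K₀/√t))`. -/
theorem abs_loopIntegral_monotone_le (S : Momentum) (θ : ℝ) {e φa φb m G₂ X₀ X₁ t K₀ : ℝ} {Kr X : ℝ → ℝ → ℝ} (he : |e| < r) (hφ : φa ≤ φb)
    (hm : 0 < m) (hG₂ : 0 ≤ G₂) (hX₀ : 0 ≤ X₀) (hX₁ : 0 ≤ X₁) (ht : 0 < t) (htK : t ≤ K₀) (hK₀ : ∀ p : Momentum, |frameLevel μ K p| ≤ K₀)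
    (hslope : ∀ v ∈ Icc φa φb, m ≤ |deriv (fun x : ℝ => frameLevel μ K (S - levelPoint μ K e (x + θ))) v|)
    (hcurv : ∀ v ∈ Icc φa φb, |iteratedDeriv 2 (fun x : ℝ => frameLevel μ K (S - levelPoint μ K e (x + θ))) v| ≤ G₂)
    (hXd : ContDiff ℝ 1 (X e)) (hXs : tsupport (X e) ⊆ Ioo φa φb) (hXb : ∀ v ∈ Ioo φa φb, |X e v| ≤ X₀) (hX₁b : ∀ v ∈ Ioo φa φb, |deriv (X e) v| ≤ X₁)
    (hKd : ContDiff ℝ 1 (Kr e)) (hK0 : ∀ y, |Kr e y| ≤ (max t |y|)⁻¹) :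
    |∫ v in φa..φb, X e v * deriv (Kr e) (frameLevel μ K (S - levelPoint μ K e (v + θ)))| ≤
      (X₀ * (G₂ / m ^ 2) + X₁ * m⁻¹) * (m⁻¹ * (4 * Real.sqrt K₀ / Real.sqrt t)) := by
  set g : ℝ → ℝ := fun x => frameLevel μ K (S - levelPoint μ K e (x + θ)) with hg
  have hgC : ContDiff ℝ 2 g := contDiff_partnerBand_angle hA hd hlo hhi S he θ
  set Gf : ℕ → ℝ := fun _ => G₂ with hGf
  set Wf : ℕ → ℝ := fun l => if l = 0 then X₀ else X₁ with hWf
  have hW0 : ∀ l, 0 ≤ Wf l := fun l => by simp only [hWf]; split_ifs <;> assumption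
  have hmain := norm_intervalIntegral_smul_iteratedDeriv_comp_le_level (E := ℝ) (g := g) (w := X e) (c := 1) (G := Gf) (W := Wf) hφ
    (by exact_mod_cast hgC) hm hslope
    (fun l h2 h2' v hv => by
      have hl : l = 2 := by omega
      subst hl; exact hcurv v hv)
    (fun _ => hG₂) hXd hXs
    (fun l hl v hv => by
      interval_cases l
      · simpa [hWf] using hXb v hv
      · simpa [hWf] using hX₁b v hv)
    hW0 (Ψ := Kr e) hKd
  -- unfold the table and the smul
  rw [loopIBPTable_one_zero, recipSlopeJet_one, recipSlopeJet_zero] at hmain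
  simp only [hWf, if_true, one_ne_zero, if_false, smul_eq_mul, iteratedDeriv_one, Real.norm_eq_abs] at hmain
  -- the level integral of the envelope
  have hK₀pos : 0 < K₀ := ht.trans_le htK
  have hlev : abs (∫ y in g φa..g φb, |Kr e y|) ≤ 4 * Real.sqrt K₀ / Real.sqrt t := by
    have hh : ∀ y, |Kr e y| ≤ (max t |y|)⁻¹ := hK0
    have hcont : Continuous fun y => (max t |y|)⁻¹ :=
      Continuous.inv₀ (continuous_const.max continuous_abs) fun y => (lt_max_of_lt_left ht).ne'
    have hKc1 : Continuous fun y => |Kr e y| := (hKd.continuous).abs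
    have hga : g φa ∈ Icc (-K₀) K₀ := abs_le.1 (hK₀ _)
    have hgb : g φb ∈ Icc (-K₀) K₀ := abs_le.1 (hK₀ _)
    -- reduce to an increasing pair of endpoints inside `[−K₀, K₀]`
    have key : ∀ p q : ℝ, p ≤ q → p ∈ Icc (-K₀) K₀ → q ∈ Icc (-K₀) K₀ → ∫ y in p..q, |Kr e y| ≤ 4 * Real.sqrt K₀ / Real.sqrt t := by
      intro p q hpq hp hq
      calc ∫ y in p..q, |Kr e y| ≤ ∫ y in p..q, (max t |y|)⁻¹ :=
            intervalIntegral.integral_mono_on hpq (hKc1.intervalIntegrable _ _) (hcont.intervalIntegrable _ _) fun y _ => hh y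
        _ ≤ ∫ y in (-K₀)..K₀, (max t |y|)⁻¹ := by
            refine intervalIntegral.integral_mono_interval hp.1 hpq hq.2 ?_ (hcont.intervalIntegrable _ _)
            exact Filter.Eventually.of_forall fun y => (inv_pos.2 (lt_max_of_lt_left ht)).le
        _ ≤ 4 * Real.sqrt K₀ / Real.sqrt t := intervalIntegral_inv_max_abs_le ht htK
    have hnn : ∀ p q : ℝ, p ≤ q → 0 ≤ ∫ y in p..q, |Kr e y| := fun p q hpq => intervalIntegral.integral_nonneg hpq fun y _ => abs_nonneg _
    rcases le_total (g φa) (g φb) with hle | hle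
    · rw [abs_of_nonneg (hnn _ _ hle)]; exact key _ _ hle hga hgb
    · rw [intervalIntegral.integral_symm, abs_neg, abs_of_nonneg (hnn _ _ hle)]; exact key _ _ hle hgb hga
  refine hmain.trans ?_
  have hc0 : 0 ≤ X₀ * (G₂ / m ^ 2) + X₁ * m⁻¹ := by positivity
  exact mul_le_mul_of_nonneg_left (mul_le_mul_of_nonneg_left hlev (by positivity)) hc0

omit hA20 hr in
/-- **THE MONOTONE BOX, POINTWISE IN `ϑ`**: box `[α,β] × [φa,φb]`, levels `0 < lo ≤ hi < r`, `hi ≤ K₀`; on the whole box the partner band has loop slope `≥ m` and loop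
curvature `≤ G₂`; weight rows (bump in `v`, jointly continuous); kernel rows (`C¹`, envelopes `1/max(|e|,|u|)` off the strip and `1/max(lo,|u|)` on it, jointly continuous
`∂ᵤK`); profile `0 ≤ w ≤ W` continuous.  THEN `F(ϑ) ≤ W·((X₀·(G₂/m²) + X₁·m⁻¹)·(m⁻¹·(4√K₀)))·(4√hi)` for every `ϑ ∈ [α,β]`. -/
theorem monotoneBox_pointwise_le (ρ θ : ℝ) {α β φa φb lo hi m G₂ X₀ X₁ K₀ W : ℝ} {Kr X : ℝ → ℝ → ℝ} {wt : ℝ → ℝ}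
    (hφ : φa ≤ φb) (hlo0 : 0 < lo) (hlohi : lo ≤ hi) (hhir : hi < r) (hhiK : hi ≤ K₀) (hm : 0 < m) (hG₂ : 0 ≤ G₂) (hX₀ : 0 ≤ X₀) (hX₁ : 0 ≤ X₁)
    (hK₀ : ∀ p : Momentum, |frameLevel μ K p| ≤ K₀)
    (hslope : ∀ ϑ ∈ Icc α β, ∀ e ∈ Icc (-hi) hi, ∀ v ∈ Icc φa φb,
      m ≤ |deriv (fun x : ℝ => frameLevel μ K (pairSumPath μ K ρ ϑ θ 0 - levelPoint μ K e (x + θ))) v|)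
    (hcurv : ∀ ϑ ∈ Icc α β, ∀ e ∈ Icc (-hi) hi, ∀ v ∈ Icc φa φb,
      |iteratedDeriv 2 (fun x : ℝ => frameLevel μ K (pairSumPath μ K ρ ϑ θ 0 - levelPoint μ K e (x + θ))) v| ≤ G₂)
    (hXd : ∀ e ∈ Icc (-hi) hi, ContDiff ℝ 1 (X e)) (hXs : ∀ e ∈ Icc (-hi) hi, tsupport (X e) ⊆ Ioo φa φb)
    (hX2 : ContinuousOn (fun p : ℝ × ℝ => X p.1 p.2) (Icc (-hi) hi ×ˢ univ))
    (hXb : ∀ e ∈ Icc (-hi) hi, ∀ v ∈ Ioo φa φb, |X e v| ≤ X₀) (hX₁b : ∀ e ∈ Icc (-hi) hi, ∀ v ∈ Ioo φa φb, |deriv (X e) v| ≤ X₁)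
    (hKd : ∀ e ∈ Icc (-hi) hi, ContDiff ℝ 1 (Kr e)) (hKc : Continuous fun p : ℝ × ℝ => deriv (Kr p.1) p.2)
    (hK0 : ∀ e ∈ Icc (-hi) hi, e ≠ 0 → ∀ u, |Kr e u| ≤ (max |e| |u|)⁻¹) (hK0s : ∀ e ∈ Icc (-lo) lo, ∀ u, |Kr e u| ≤ (max lo |u|)⁻¹)
    (hwc : ContinuousOn wt (Icc (-hi) hi)) (hw0 : ∀ e ∈ Icc (-hi) hi, 0 ≤ wt e) (hwW : ∀ e ∈ Icc (-hi) hi, wt e ≤ W)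
    {ϑ : ℝ} (hϑ : ϑ ∈ Icc α β) :
    |∫ e in (-hi)..hi, ∫ v in φa..φb, wt e * (X e v * deriv (Kr e) (frameLevel μ K (pairSumPath μ K ρ ϑ θ 0 - levelPoint μ K e (v + θ))))| ≤
      W * ((X₀ * (G₂ / m ^ 2) + X₁ * m⁻¹) * (m⁻¹ * (4 * Real.sqrt K₀))) * (4 * Real.sqrt hi) := by
  set S : Momentum := pairSumPath μ K ρ ϑ θ 0 with hS
  have hhi0 : 0 < hi := hlo0.trans_le hlohi
  have hhh : -hi ≤ hi := by linarith only [hhi0]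
  have h0I : (0 : ℝ) ∈ Icc (-hi) hi := ⟨by linarith only [hhi0], hhi0.le⟩
  have hW0 : 0 ≤ W := (hw0 0 h0I).trans (hwW 0 h0I)
  set c₁ : ℝ := (X₀ * (G₂ / m ^ 2) + X₁ * m⁻¹) * (m⁻¹ * (4 * Real.sqrt K₀)) with hc₁
  have hc₁0 : 0 ≤ c₁ := by positivity
  -- per level: the monotone IBP bound with the floor `t = max lo |e|`
  have hline : ∀ e ∈ Icc (-hi) hi, |∫ v in φa..φb, X e v * deriv (Kr e) (frameLevel μ K (S - levelPoint μ K e (v + θ)))| ≤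
      c₁ * (Real.sqrt (max lo |e|))⁻¹ := fun e he => by
    have her : |e| < r := abs_lt.2 ⟨by linarith only [he.1, hhir], lt_of_le_of_lt he.2 hhir⟩
    have ht : 0 < max lo |e| := lt_max_of_lt_left hlo0
    have htK : max lo |e| ≤ K₀ := max_le (hlohi.trans hhiK) ((abs_le.2 ⟨he.1, he.2⟩).trans hhiK)
    have henv : ∀ y, |Kr e y| ≤ (max (max lo |e|) |y|)⁻¹ := fun y => by
      rcases le_or_gt |e| lo with hle | hgt
      · rw [max_eq_left hle]; exact hK0s e (abs_le.1 hle) y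
      · rw [max_eq_right hgt.le]
        exact hK0 e he (abs_pos.1 (hlo0.trans hgt)) y
    have h := abs_loopIntegral_monotone_le hA hd hlo hhi S θ her hφ hm hG₂ hX₀ hX₁ ht htK hK₀ (hslope ϑ hϑ e he) (hcurv ϑ hϑ e he)
      (hXd e he) (hXs e he) (hXb e he) (hX₁b e he) (hKd e he) henv
    refine h.trans (le_of_eq ?_)
    rw [hc₁]; field_simp
  -- the level layer
  have hglue := abs_intervalIntegral2_le_outer (Ψ := fun e v => X e v * deriv (Kr e) (frameLevel μ K (S - levelPoint μ K e (v + θ))))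
    (w := wt) (α := φa) (β := φb) hhh hw0
  refine hglue.trans ?_
  have hgi := levelLayer_intervalIntegrable hA hd hlo hhi S θ (φa := φa) (φb := φb) hhi0.le hhir hX2 hKc hwc
  have hmaj : Continuous fun e : ℝ => W * c₁ * (Real.sqrt (max lo |e|))⁻¹ :=
    continuous_const.mul (Continuous.inv₀ ((continuous_const.max continuous_abs).sqrt) fun e => (Real.sqrt_pos.2 (lt_max_of_lt_left hlo0)).ne')
  calc ∫ e in (-hi)..hi, wt e * |∫ v in φa..φb, X e v * deriv (Kr e) (frameLevel μ K (S - levelPoint μ K e (v + θ)))|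
      ≤ ∫ e in (-hi)..hi, W * c₁ * (Real.sqrt (max lo |e|))⁻¹ := by
        refine intervalIntegral.integral_mono_on hhh hgi (hmaj.intervalIntegrable _ _) fun e he => ?_
        have h1 := hline e he
        have h2 : 0 ≤ c₁ * (Real.sqrt (max lo |e|))⁻¹ := by positivity
        calc wt e * |∫ v in φa..φb, X e v * deriv (Kr e) (frameLevel μ K (S - levelPoint μ K e (v + θ)))| ≤ W * (c₁ * (Real.sqrt (max lo |e|))⁻¹) :=
              mul_le_mul (hwW e he) h1 (abs_nonneg _) hW0
          _ = W * c₁ * (Real.sqrt (max lo |e|))⁻¹ := by ring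
    _ = W * c₁ * ∫ e in (-hi)..hi, (Real.sqrt (max lo |e|))⁻¹ := intervalIntegral.integral_const_mul _ _
    _ ≤ W * c₁ * (4 * Real.sqrt hi) := mul_le_mul_of_nonneg_left (intervalIntegral_inv_sqrt_max_abs_le hlo0 hlohi) (by positivity)

omit hA20 hr in
/-- **THE MONOTONE BOX** (HEADLINE): under the hypotheses of `monotoneBox_pointwise_le` with `α ≤ β`,
`∫_{α..β} |∫_{−hi..hi} ∫_{φa..φb} w·(X·(K e)′(ē))| dϑ ≤ (β − α)·(W·((X₀·(G₂/m²) + X₁·m⁻¹)·(m⁻¹·(4√K₀)))·(4√hi))` — `lo`-free, no fold structure, no sign condition,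
no integrability hypothesis. -/
theorem monotoneBox_integral_le (ρ θ : ℝ) {α β φa φb lo hi m G₂ X₀ X₁ K₀ W : ℝ} {Kr X : ℝ → ℝ → ℝ} {wt : ℝ → ℝ}
    (hαβ : α ≤ β) (hφ : φa ≤ φb) (hlo0 : 0 < lo) (hlohi : lo ≤ hi) (hhir : hi < r) (hhiK : hi ≤ K₀) (hm : 0 < m) (hG₂ : 0 ≤ G₂) (hX₀ : 0 ≤ X₀) (hX₁ : 0 ≤ X₁)
    (hK₀ : ∀ p : Momentum, |frameLevel μ K p| ≤ K₀)
    (hslope : ∀ ϑ ∈ Icc α β, ∀ e ∈ Icc (-hi) hi, ∀ v ∈ Icc φa φb,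
      m ≤ |deriv (fun x : ℝ => frameLevel μ K (pairSumPath μ K ρ ϑ θ 0 - levelPoint μ K e (x + θ))) v|)
    (hcurv : ∀ ϑ ∈ Icc α β, ∀ e ∈ Icc (-hi) hi, ∀ v ∈ Icc φa φb,
      |iteratedDeriv 2 (fun x : ℝ => frameLevel μ K (pairSumPath μ K ρ ϑ θ 0 - levelPoint μ K e (x + θ))) v| ≤ G₂)
    (hXd : ∀ e ∈ Icc (-hi) hi, ContDiff ℝ 1 (X e)) (hXs : ∀ e ∈ Icc (-hi) hi, tsupport (X e) ⊆ Ioo φa φb)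
    (hX2 : ContinuousOn (fun p : ℝ × ℝ => X p.1 p.2) (Icc (-hi) hi ×ˢ univ))
    (hXb : ∀ e ∈ Icc (-hi) hi, ∀ v ∈ Ioo φa φb, |X e v| ≤ X₀) (hX₁b : ∀ e ∈ Icc (-hi) hi, ∀ v ∈ Ioo φa φb, |deriv (X e) v| ≤ X₁)
    (hKd : ∀ e ∈ Icc (-hi) hi, ContDiff ℝ 1 (Kr e)) (hKc : Continuous fun p : ℝ × ℝ => deriv (Kr p.1) p.2)
    (hK0 : ∀ e ∈ Icc (-hi) hi, e ≠ 0 → ∀ u, |Kr e u| ≤ (max |e| |u|)⁻¹) (hK0s : ∀ e ∈ Icc (-lo) lo, ∀ u, |Kr e u| ≤ (max lo |u|)⁻¹)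
    (hwc : ContinuousOn wt (Icc (-hi) hi)) (hw0 : ∀ e ∈ Icc (-hi) hi, 0 ≤ wt e) (hwW : ∀ e ∈ Icc (-hi) hi, wt e ≤ W) :
    ∫ ϑ in α..β, |∫ e in (-hi)..hi, ∫ v in φa..φb, wt e * (X e v * deriv (Kr e) (frameLevel μ K (pairSumPath μ K ρ ϑ θ 0 - levelPoint μ K e (v + θ))))| ≤
      (β - α) * (W * ((X₀ * (G₂ / m ^ 2) + X₁ * m⁻¹) * (m⁻¹ * (4 * Real.sqrt K₀))) * (4 * Real.sqrt hi)) := by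
  have hpt : ∀ ϑ ∈ Ι α β, ‖|∫ e in (-hi)..hi, ∫ v in φa..φb, wt e * (X e v * deriv (Kr e) (frameLevel μ K (pairSumPath μ K ρ ϑ θ 0 - levelPoint μ K e (v + θ))))|‖ ≤
      W * ((X₀ * (G₂ / m ^ 2) + X₁ * m⁻¹) * (m⁻¹ * (4 * Real.sqrt K₀))) * (4 * Real.sqrt hi) := fun ϑ hϑ => by
    rw [uIoc_of_le hαβ] at hϑ
    rw [Real.norm_eq_abs, abs_abs]
    exact monotoneBox_pointwise_le hA hd hlo hhi ρ θ hφ hlo0 hlohi hhir hhiK hm hG₂ hX₀ hX₁ hK₀ hslope hcurv hXd hXs hX2 hXb hX₁b hKd hKc hK0 hK0s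
      hwc hw0 hwW (Ioc_subset_Icc_self hϑ)
  have h := intervalIntegral.norm_integral_le_of_norm_le_const hpt
  rw [Real.norm_eq_abs, abs_of_nonneg (sub_nonneg.2 hαβ)] at h
  refine (le_abs_self _).trans (h.trans (le_of_eq ?_))
  ring

end Sizes

end Summit.HubbardSuperconductivity.HubbardSuperconductivity.Theorems.C4a

end
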